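import Literature.NumberTheory.QuadraticFields.ChowlaSelbergFifteenSum
import Literature.NumberTheory.QuadraticFields.JacobiCharacterPrimitiveProofs
import Literature.NumberTheory.LFunctions.LerchFormula
import Literature.NumberTheory.LFunctions.OddCharLogDerivFE
import Literature.NumberTheory.LFunctions.DirichletLAtZero
import HarnessLib

/-!
# Chowla–Selberg at `D = −15`, IV: `L′(1, χ₋₁₅)` through `log Γ` at fifteenths

Topic `NumberTheory/QuadraticFields`, namespace
`Literature.NumberTheory.QuadraticFields.ChowlaSelbergFifteen` (sequel of
`ChowlaSelbergFifteenSum.lean`). Everything here is PROVED (theorems only; no definitions, no named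
facts).

For the odd primitive real character `χ = χ₋₁₅ = (·/15)` (`jacobiChar 15`):

* `LFunction_chi_zero` — `L(0, χ) = 2` (`= −B_{1,χ}`, tree `dirichletLFunction_apply_zero_of_odd`;
  `Σ_{a<15} a χ(a) = −30`);
* `sum_chi_mul_log_Gamma` — `Σ_{a<15} χ(a) log Γ(a/15) = log Γ(1/15) + log Γ(2/15) + log Γ(4/15)
  + log Γ(8/15) − log Γ(7/15) − log Γ(11/15) − log Γ(13/15) − log Γ(14/15)` (=: `Γs`);
* `deriv_LFunction_chi_zero` — `L′(0, χ) = −2 log 15 + Γs` (Lerch, tree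
  `Lerch.deriv_LFunction_zero_of_ne_one`);
* `deriv_LFunction_chi_one` — **`L′(1, χ) = (2π/√15)(γ + log 2π − Γs/2)`**: the functional
  equation in logarithmic-derivative form `L′/L(0, χ) + L′/L(1, χ) = γ + log(2π/15)` (tree
  `OddCharLogDeriv.logDeriv_LFunction_zero_add_one`) with `L(1, χ) = 2π/√15`
  (`LFunction_chi_one`) and `L(0, χ) = 2`.

This is the Dirichlet-series side of the Chowla–Selberg formula at `D = −15`
(Selberg–Chowla 1967, §2, (6)–(8)): the `log Γ(a/15)` enter only here.

## References

* A. Selberg, S. Chowla, On Epstein's zeta-function, J. reine angew. Math. 227 (1967) 86–110,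
  §2 eqs. (6)–(8).
* [BorweinBorwein1987] J. M. Borwein, P. B. Borwein, *Pi and the AGM* (1987), §9.2.
* [Washington1997] L. C. Washington, *Introduction to Cyclotomic Fields*, 2nd ed., Thm. 4.2
  (`L(0, χ) = −B_{1,χ}`).
-/

noncomputable section

open Complex Filter Topology Finset
open Literature.NumberTheory.LFunctions

namespace Literature.NumberTheory.QuadraticFields.ChowlaSelbergFifteen

/-- `χ₋₁₅` is odd (`15 ≡ 3 (mod 4)`). [folklore] -/
theorem jacobiChar_fifteen_odd : (jacobiChar 15).Odd :=
  jacobiChar_neg_one_of_mod_four_eq_three (by norm_num)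

/-- `χ₋₁₅` is primitive (`15` odd and square-free). [folklore] -/
theorem jacobiChar_fifteen_isPrimitive : (jacobiChar 15).IsPrimitive :=
  isPrimitive_jacobiChar (by decide) (by
    rw [show (15 : ℕ) = 3 * 5 by norm_num, Nat.squarefree_mul (by norm_num)]
    exact ⟨Nat.prime_three.squarefree, Nat.prime_five.squarefree⟩)

/-- The values of `χ₋₁₅` summed against `a`: `Σ_{a<15} a χ(a) = −30` (`B_{1,χ₋₁₅} = −2`). [folklore] -/
theorem sum_val_mul_chi : ∑ a : ZMod 15, (a.val : ℂ) * jacobiChar 15 a = -30 := by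
  rw [Lerch.sum_univ_zmod_eq_sum_range (fun j v => (v : ℂ) * jacobiChar 15 j)]
  simp only [Finset.sum_range_succ, Finset.sum_range_zero, jacobiChar_natCast]
  norm_num

/-- **`L(0, χ₋₁₅) = 2`.** [cite: Washington1997, Theorem 4.2] -/
theorem LFunction_chi_zero : (jacobiChar 15).LFunction 0 = 2 := by
  rw [LValueZero.dirichletLFunction_apply_zero_of_odd jacobiChar_fifteen_odd, sum_val_mul_chi]
  norm_num

/-- **`Σ_{a<15} χ₋₁₅(a) log Γ(a/15)`** written out: `χ = +1` on `{1, 2, 4, 8}`, `−1` on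
`{7, 11, 13, 14}`, `0` elsewhere. [folklore] -/
theorem sum_chi_mul_log_Gamma :
    ∑ a ∈ Finset.range 15, jacobiChar 15 a * (Real.log (Real.Gamma ((a : ℝ) / ((15 : ℕ) : ℝ))) : ℂ) =
      ((Real.log (Real.Gamma (1 / 15)) + Real.log (Real.Gamma (2 / 15)) +
        Real.log (Real.Gamma (4 / 15)) + Real.log (Real.Gamma (8 / 15)) -
        Real.log (Real.Gamma (7 / 15)) - Real.log (Real.Gamma (11 / 15)) -
        Real.log (Real.Gamma (13 / 15)) - Real.log (Real.Gamma (14 / 15)) : ℝ) : ℂ) := by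
  simp only [Finset.sum_range_succ, Finset.sum_range_zero, jacobiChar_natCast]
  norm_num
  ring

/-- **`L′(0, χ₋₁₅) = −2 log 15 + Σ χ(a) log Γ(a/15)`** (Lerch's formula). [folklore] -/
theorem deriv_LFunction_chi_zero :
    deriv (jacobiChar 15).LFunction 0 =
      ((-2 * Real.log 15 + (Real.log (Real.Gamma (1 / 15)) + Real.log (Real.Gamma (2 / 15)) +
        Real.log (Real.Gamma (4 / 15)) + Real.log (Real.Gamma (8 / 15)) -
        Real.log (Real.Gamma (7 / 15)) - Real.log (Real.Gamma (11 / 15)) -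
        Real.log (Real.Gamma (13 / 15)) - Real.log (Real.Gamma (14 / 15))) : ℝ) : ℂ) := by
  rw [Lerch.deriv_LFunction_zero_of_ne_one jacobiChar_fifteen_ne_one, LFunction_chi_zero,
    sum_chi_mul_log_Gamma]
  push_cast
  ring

/-- **`L′(1, χ₋₁₅) = (2π/√15)(γ + log 2π − ½ Σ χ(a) log Γ(a/15))`**: the logarithmic-derivative
functional equation `L′/L(0) + L′/L(1) = γ + log(2π/15)` with `L(0) = 2`, `L(1) = 2π/√15` and
Lerch's `L′(0)`. [cite: BorweinBorwein1987, §9.2] -/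
theorem deriv_LFunction_chi_one :
    deriv (jacobiChar 15).LFunction 1 =
      ((2 * Real.pi / Real.sqrt 15 * (Real.eulerMascheroniConstant + Real.log (2 * Real.pi) -
        (Real.log (Real.Gamma (1 / 15)) + Real.log (Real.Gamma (2 / 15)) +
          Real.log (Real.Gamma (4 / 15)) + Real.log (Real.Gamma (8 / 15)) -
          Real.log (Real.Gamma (7 / 15)) - Real.log (Real.Gamma (11 / 15)) -
          Real.log (Real.Gamma (13 / 15)) - Real.log (Real.Gamma (14 / 15))) / 2) : ℝ) : ℂ) := by
  set χ := jacobiChar 15 with hχ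
  have hFE := OddCharLogDeriv.logDeriv_LFunction_zero_add_one jacobiChar_fifteen_isPrimitive
    jacobiChar_fifteen_odd
  rw [(isQuadratic_jacobiChar (q := 15)).inv, ← hχ] at hFE
  have h0 : χ.LFunction 0 = 2 := LFunction_chi_zero
  have h1 : χ.LFunction 1 = ((2 * Real.pi / Real.sqrt 15 : ℝ) : ℂ) := LFunction_chi_one
  have hd0 := deriv_LFunction_chi_zero
  rw [← hχ] at hd0
  set Γs : ℝ := Real.log (Real.Gamma (1 / 15)) + Real.log (Real.Gamma (2 / 15)) +
      Real.log (Real.Gamma (4 / 15)) + Real.log (Real.Gamma (8 / 15)) -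
      Real.log (Real.Gamma (7 / 15)) - Real.log (Real.Gamma (11 / 15)) -
      Real.log (Real.Gamma (13 / 15)) - Real.log (Real.Gamma (14 / 15)) with hΓs
  have hP : (0 : ℝ) < 2 * Real.pi / Real.sqrt 15 := by positivity
  have hP0 : ((2 * Real.pi / Real.sqrt 15 : ℝ) : ℂ) ≠ 0 := ofReal_ne_zero.mpr hP.ne'
  rw [h0, h1, hd0] at hFE
  -- solve the linear equation for `L′(1)`
  have hlog : Real.log (2 * Real.pi / (15 : ℕ)) = Real.log (2 * Real.pi) - Real.log 15 := by
    push_cast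
    rw [Real.log_div (by positivity) (by norm_num)]
  rw [hlog] at hFE
  have key : deriv χ.LFunction 1 = ((2 * Real.pi / Real.sqrt 15 : ℝ) : ℂ) *
      ((Real.eulerMascheroniConstant : ℂ) + ((Real.log (2 * Real.pi) - Real.log 15 : ℝ) : ℂ) -
        ((-2 * Real.log 15 + Γs : ℝ) : ℂ) / 2) := by
    have e : deriv χ.LFunction 1 / ((2 * Real.pi / Real.sqrt 15 : ℝ) : ℂ) =
        (Real.eulerMascheroniConstant : ℂ) + ((Real.log (2 * Real.pi) - Real.log 15 : ℝ) : ℂ) -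
          ((-2 * Real.log 15 + Γs : ℝ) : ℂ) / 2 := by
      rw [← hFE]; ring
    rw [← e]
    field_simp
  rw [key]
  push_cast
  ring

end Literature.NumberTheory.QuadraticFields.ChowlaSelbergFifteen
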